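import Summits.CriticalPhenomena.PercolationContinuityZ3.Theorems.PercNearOneGluingNoHeavyQuantRushbrookeInequality
import Summits.CriticalPhenomena.PercolationContinuityZ3.Theorems.PercNearOneGluingNoHeavyQuantThetaHolderFromDerivative
import HarnessLib

/-!
# RUSHBROOKE'S SCALING INEQUALITY `α' + 2β + γ' ≥ 2` AS AN EXPLICIT HÖLDER MODULUS OF CONTINUITY OF `θ` AT `p_c`:
# amplitude bounds on `κ''` and `χ^f` just above `p_c` ⟹ `θ(q) ≤ C (q − p_c)^{1 − (α'+γ')/2}` — every `d ≥ 2`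
# — quant lane, METHOD = differential inequalities for `θ` near `p_c`, seat p4 gen 34, file 3

builds on p205010 (kernel theorem, internal audit signed; external expert review pending).
Status sentence for p205010: "θ(p_c) = 0 on ℤ^d, all d ≥ 2 — kernel-verified (Lean 4/Mathlib, standard axioms); internal
adversarial audit SIGNED 2026-08-20 04:29Z; external expert review pending."  (p205010 is USED only in the last theorem,
`thetaHolderNearCritical_of_rushbrooke`, through file 2's `HolderDict.thetaHolderNearCritical_of_deriv_le_rpow`; the derivative
bound and the increment form are p205010-free.)

Seat `prim-quant-p4`, `--supports stmt-CriticalPhenomena-4575`; pure proofs, no definitions (`local notation3` only).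
Notation: `θ(s) = theta (zdGraph d) 0 (prm s)`, `χ^f(s) = (meanClusterSize (zdGraph d) 0 (prm s)).toReal`, `κ = kappa (zdGraph d) 0 ∘ prm`,
`p_c = criticalProbI d`; `K = 2d/(p_c(1 − p_c − s₀))²`.

Inputs: file 1 (`…QuantRushbrookeInequality`, `Thermo.sq_deriv_theta_le`): `(θ')² ≤ χ^f (κ'' + 2d(1−θ)/(q(1−q))²)` on `(p_c,1)`;
file 2 (`…QuantThetaHolderFromDerivative`): a power bound on `θ'` integrates to a Hölder bound on `θ(q) − θ(p_c)` (and, with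
`θ(p_c) = 0`, to `Quant.ThetaHolderNearCritical`).  Durrett–Nguyen (1985, p. 261) derive `α' + 2β + γ' ≥ 2` from the `h > 0`
version of file 1's inequality ASSUMING the three exponents exist; here the scaling inequality becomes an implication between
AMPLITUDE BOUNDS with explicit constants:

* §1 `Thermo.corr_le` — on `(p_c, p_c + s₀)` the correction term is at most `K`; **`Thermo.deriv_theta_le_rpow`** — if
  `κ''(q) ≤ A (q − p_c)^{-a}` and `χ^f(q) ≤ G (q − p_c)^{-g}` there (`A, G, a ≥ 0`), then
  `θ'(q) ≤ √(G(A + K s₀^a)) · (q − p_c)^{−(a+g)/2}`.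
* §2 **`Thermo.theta_sub_theta_le_rpow_of_rushbrooke`** (p205010-free): with moreover `a + g < 2`,
  `θ(q) − θ(p_c) ≤ (√(G(A + K s₀^a))/(1 − (a+g)/2)) · (q − p_c)^{1−(a+g)/2}` for `q ∈ (p_c, p_c + s₀)` ("`β ≥ 1 − (α'+γ')/2`");
  **`Thermo.thetaHolderNearCritical_of_rushbrooke`** (p205010): `Quant.ThetaHolderNearCritical d (1 − (a+g)/2) C` with
  `C = max (√(G(A + K s₀^a))/(1 − (a+g)/2)) (s₀^{−(1−(a+g)/2)})`.

HONEST STATUS.  Bookkeeping on files 1–2, NEW AS TYPED; CONDITIONAL on amplitude bounds for `κ''` and `χ^f` at `p_c⁺`, both OPEN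
for `3 ≤ d ≤ 6`.  Orientation (numbers, not claims): in `d = 2`, `κ''` is bounded across `p_c` (Kesten's Thm. 9.4, tree) but
`γ = 43/18 > 2`, so the hypothesis `a + g < 2` is not expected to be satisfiable and the row is vacuous there; for `d = 3` the
numerical values `γ ≈ 1.8`, `α ≈ −0.6` would give `β ≥ 0.1` (against `β ≈ 0.41`).  NO rate and NO exponent for `d = 3` is claimed;
(T1)/(T2) and the lane's honest sentence UNCHANGED.

## References
* R. Durrett, B. Nguyen, *Thermodynamic inequalities for percolation*, Comm. Math. Phys. 99 (1985) 253–269, §1 (3), §3 p. 261 [DurrettNguyen1985].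
* H. Kesten, *Percolation Theory for Mathematicians* (1982), Thm. 9.4 [Kesten1982].
* G. Grimmett, *Percolation*, 2nd ed. (1999): §10.2 notes p. 278, Thm. (8.92) [GrimmettPercolation1999].
-/

noncomputable section

namespace Summit.CriticalPhenomena.PercolationContinuityZ3.Theorems

open MeasureTheory Set Filter Topology Literature.Probability.Percolation Literature.Probability.LatticeModels
open scoped Classical ENNReal

namespace Thermo

variable {d : ℕ}

/-- `TH[s] = θ(prm s)`. -/
local notation3 "TH[" s "]" => theta (zdGraph d) 0 (GhostField.prm s)

/-- `CHI[s] = χ^f(prm s)` (real). -/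
local notation3 "CHI[" s "]" => (meanClusterSize (zdGraph d) (0 : Site d) (GhostField.prm s)).toReal

/-- `KAP = κ ∘ prm`. -/
local notation3 "KAP" => fun s : ℝ => kappa (zdGraph d) 0 (GhostField.prm s)

/-! ### §1. The derivative bound under amplitude hypotheses -/

/-- The correction term is bounded on `(p_c, p_c + s₀)`: `2d(1−θ)/(q(1−q))² ≤ 2d/(p_c(1 − p_c − s₀))²`. [folklore] -/
theorem corr_le (hd : 2 ≤ d) {s₀ q : ℝ} (hs1 : (criticalProbI d : ℝ) + s₀ < 1)
    (hq : q ∈ Set.Ioo (criticalProbI d : ℝ) (criticalProbI d + s₀)) :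
    2 * d * (1 - TH[q]) / (q * (1 - q)) ^ 2 ≤ 2 * d / ((criticalProbI d : ℝ) * (1 - criticalProbI d - s₀)) ^ 2 := by
  have hpc := ChiF.criticalProbI_pos hd
  obtain ⟨hθ0, -⟩ := ChiF.theta_prm_nonneg_le_one (d := d) q
  have hpos : 0 < (criticalProbI d : ℝ) * (1 - criticalProbI d - s₀) := mul_pos hpc (by linarith)
  have hlow : (criticalProbI d : ℝ) * (1 - criticalProbI d - s₀) ≤ q * (1 - q) :=
    mul_le_mul hq.1.le (by linarith [hq.2]) (by linarith) (by linarith [hq.1])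
  have hsq : ((criticalProbI d : ℝ) * (1 - criticalProbI d - s₀)) ^ 2 ≤ (q * (1 - q)) ^ 2 :=
    pow_le_pow_left₀ hpos.le hlow 2
  have hqq2 : 0 < (q * (1 - q)) ^ 2 := lt_of_lt_of_le (pow_pos hpos 2) hsq
  have hd0 : (0 : ℝ) ≤ 2 * d := by positivity
  calc 2 * d * (1 - TH[q]) / (q * (1 - q)) ^ 2 ≤ 2 * d / (q * (1 - q)) ^ 2 := by
        refine div_le_div_of_nonneg_right ?_ hqq2.le
        nlinarith
    _ ≤ 2 * d / ((criticalProbI d : ℝ) * (1 - criticalProbI d - s₀)) ^ 2 :=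
        div_le_div_of_nonneg_left hd0 (pow_pos hpos 2) hsq

/-- **Rushbrooke under amplitude bounds**: if `κ'' ≤ A(q − p_c)^{-a}` and `χ^f ≤ G(q − p_c)^{-g}` on `(p_c, p_c + s₀)`
(`A, G, a ≥ 0`), then `θ'(q) ≤ √(G(A + K s₀^a)) · (q − p_c)^{−(a+g)/2}` there, `K = 2d/(p_c(1 − p_c − s₀))²`.
[cite: DurrettNguyen1985, §3 p. 261 (Rushbrooke)] -/
theorem deriv_theta_le_rpow (hd : 2 ≤ d) {s₀ A G a g : ℝ} (hs0 : 0 < s₀) (hs1 : (criticalProbI d : ℝ) + s₀ < 1)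
    (hA : 0 ≤ A) (hG : 0 ≤ G) (ha : 0 ≤ a)
    (hκ : ∀ q ∈ Set.Ioo (criticalProbI d : ℝ) (criticalProbI d + s₀),
      deriv (deriv KAP) q ≤ A * (q - criticalProbI d) ^ (-a))
    (hχ : ∀ q ∈ Set.Ioo (criticalProbI d : ℝ) (criticalProbI d + s₀), CHI[q] ≤ G * (q - criticalProbI d) ^ (-g))
    {q : ℝ} (hq : q ∈ Set.Ioo (criticalProbI d : ℝ) (criticalProbI d + s₀)) :
    deriv (fun s : ℝ => TH[s]) q ≤
      Real.sqrt (G * (A + 2 * d / ((criticalProbI d : ℝ) * (1 - criticalProbI d - s₀)) ^ 2 * s₀ ^ a)) *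
        (q - criticalProbI d) ^ (-((a + g) / 2)) := by
  set pc : ℝ := (criticalProbI d : ℝ) with hpc_def
  set K : ℝ := 2 * d / (pc * (1 - pc - s₀)) ^ 2 with hK_def
  have ht0 : 0 < q - pc := sub_pos.2 hq.1
  have hts : q - pc ≤ s₀ := by linarith [hq.2]
  have hq1 : q ∈ Set.Ioo pc 1 := ⟨hq.1, by linarith [hq.2]⟩
  have hR := sq_deriv_theta_le hd hq1
  have hpc := ChiF.criticalProbI_pos hd
  have hK0 : 0 ≤ K := div_nonneg (by positivity) (sq_nonneg _)
  have hcorr : 2 * d * (1 - TH[q]) / (q * (1 - q)) ^ 2 ≤ K := corr_le hd hs1 hq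
  -- `1 ≤ s₀^a (q - p_c)^{-a}`
  have hta : 1 ≤ s₀ ^ a * (q - pc) ^ (-a) := by
    have h1 : (q - pc) ^ a ≤ s₀ ^ a := Real.rpow_le_rpow ht0.le hts ha
    have htpos : 0 < (q - pc) ^ a := Real.rpow_pos_of_pos ht0 a
    rw [Real.rpow_neg ht0.le, ← div_eq_mul_inv, one_le_div htpos]
    exact h1
  have hB : deriv (deriv KAP) q + 2 * d * (1 - TH[q]) / (q * (1 - q)) ^ 2 ≤ (A + K * s₀ ^ a) * (q - pc) ^ (-a) := by
    have h1 := hκ q hq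
    have h2 : K ≤ K * (s₀ ^ a * (q - pc) ^ (-a)) := le_mul_of_one_le_right hK0 hta
    calc deriv (deriv KAP) q + 2 * d * (1 - TH[q]) / (q * (1 - q)) ^ 2 ≤ A * (q - pc) ^ (-a) + K := add_le_add h1 hcorr
      _ ≤ A * (q - pc) ^ (-a) + K * (s₀ ^ a * (q - pc) ^ (-a)) := by linarith
      _ = (A + K * s₀ ^ a) * (q - pc) ^ (-a) := by ring
  have hAK : 0 ≤ A + K * s₀ ^ a := add_nonneg hA (mul_nonneg hK0 (Real.rpow_nonneg hs0.le a))
  have hB0 : 0 ≤ (A + K * s₀ ^ a) * (q - pc) ^ (-a) := mul_nonneg hAK (Real.rpow_nonneg ht0.le _)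
  have hχ0 : 0 ≤ CHI[q] := ENNReal.toReal_nonneg
  have hprod : (q - pc) ^ (-g) * (q - pc) ^ (-a) = (q - pc) ^ (-(a + g)) := by
    rw [← Real.rpow_add ht0]
    congr 1
    ring
  have hsq : (deriv (fun s : ℝ => TH[s]) q) ^ 2 ≤ (G * (A + K * s₀ ^ a)) * (q - pc) ^ (-(a + g)) := by
    calc (deriv (fun s : ℝ => TH[s]) q) ^ 2 ≤ CHI[q] * (deriv (deriv KAP) q + 2 * d * (1 - TH[q]) / (q * (1 - q)) ^ 2) := hR
      _ ≤ CHI[q] * ((A + K * s₀ ^ a) * (q - pc) ^ (-a)) := mul_le_mul_of_nonneg_left hB hχ0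
      _ ≤ (G * (q - pc) ^ (-g)) * ((A + K * s₀ ^ a) * (q - pc) ^ (-a)) := mul_le_mul_of_nonneg_right (hχ q hq) hB0
      _ = (G * (A + K * s₀ ^ a)) * ((q - pc) ^ (-g) * (q - pc) ^ (-a)) := by ring
      _ = (G * (A + K * s₀ ^ a)) * (q - pc) ^ (-(a + g)) := by rw [hprod]
  have hθ'0 : 0 ≤ deriv (fun s : ℝ => TH[s]) q := (ChiF.deriv_theta_pos hd hq1.1 hq1.2).le
  have hM0 : 0 ≤ G * (A + K * s₀ ^ a) := mul_nonneg hG hAK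
  calc deriv (fun s : ℝ => TH[s]) q = Real.sqrt ((deriv (fun s : ℝ => TH[s]) q) ^ 2) := (Real.sqrt_sq hθ'0).symm
    _ ≤ Real.sqrt ((G * (A + K * s₀ ^ a)) * (q - pc) ^ (-(a + g))) := Real.sqrt_le_sqrt hsq
    _ = Real.sqrt (G * (A + K * s₀ ^ a)) * (q - pc) ^ (-((a + g) / 2)) := by
        rw [Real.sqrt_mul hM0, Real.sqrt_eq_rpow ((q - pc) ^ (-(a + g))), ← Real.rpow_mul ht0.le]
        congr 2
        ring

/-! ### §2. Integration: the increment form and the lane's Hölder-modulus statement -/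

/-- **THE SCALING INEQUALITY `α' + 2β + γ' ≥ 2` AS A MODULUS (p205010-free increment form).**  For `d ≥ 2`: if on
`(p_c, p_c + s₀)` (`0 < s₀`, `p_c + s₀ < 1`) `κ''(q) ≤ A (q − p_c)^{-a}` and `χ^f(q) ≤ G (q − p_c)^{-g}` with `A, G, a ≥ 0`, `a + g < 2`,
then for every `q ∈ (p_c, p_c + s₀)`:
`θ(q) − θ(p_c) ≤ (√(G(A + K s₀^a)) / (1 − (a+g)/2)) · (q − p_c)^{1 − (a+g)/2}` — i.e. `β ≥ 1 − (α' + γ')/2` with explicit constants.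
[cite: DurrettNguyen1985, §1 (3) and §3 p. 261] -/
theorem theta_sub_theta_le_rpow_of_rushbrooke (hd : 2 ≤ d) {s₀ A G a g : ℝ} (hs0 : 0 < s₀)
    (hs1 : (criticalProbI d : ℝ) + s₀ < 1) (hA : 0 ≤ A) (hG : 0 ≤ G) (ha : 0 ≤ a) (hag : a + g < 2)
    (hκ : ∀ q ∈ Set.Ioo (criticalProbI d : ℝ) (criticalProbI d + s₀),
      deriv (deriv KAP) q ≤ A * (q - criticalProbI d) ^ (-a))
    (hχ : ∀ q ∈ Set.Ioo (criticalProbI d : ℝ) (criticalProbI d + s₀), CHI[q] ≤ G * (q - criticalProbI d) ^ (-g))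
    {q : ℝ} (hq : q ∈ Set.Ioo (criticalProbI d : ℝ) (criticalProbI d + s₀)) :
    TH[q] - theta (zdGraph d) 0 (criticalProbI d) ≤
      Real.sqrt (G * (A + 2 * d / ((criticalProbI d : ℝ) * (1 - criticalProbI d - s₀)) ^ 2 * s₀ ^ a)) / (1 - (a + g) / 2) *
        (q - criticalProbI d) ^ (1 - (a + g) / 2) :=
  HolderDict.theta_sub_theta_le_of_deriv_le_rpow hd hs1.le (Real.sqrt_nonneg _) (by linarith)
    (fun s hs => deriv_theta_le_rpow hd hs0 hs1 hA hG ha hκ hχ hs) hq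

/-- **RUSHBROOKE ⟹ (T2, Hölder form)**: under the amplitude bounds of `theta_sub_theta_le_rpow_of_rushbrooke` and with
`θ(p_c) = 0` (p205010), `Quant.ThetaHolderNearCritical d (1 − (a+g)/2) C` with the explicit
`C = max (√(G(A + K s₀^a))/(1 − (a+g)/2)) (s₀^{−(1 − (a+g)/2)})`: `θ(p) ≤ C (p − p_c)^{1−(a+g)/2}` for every `p ≥ p_c`.
builds on p205010 (kernel theorem, internal audit signed; external expert review pending).
[cite: DurrettNguyen1985, §1 (3) and §3 p. 261] -/
theorem thetaHolderNearCritical_of_rushbrooke (hd : 2 ≤ d) {s₀ A G a g : ℝ} (hs0 : 0 < s₀)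
    (hs1 : (criticalProbI d : ℝ) + s₀ < 1) (hA : 0 ≤ A) (hG : 0 ≤ G) (ha : 0 ≤ a) (hag : a + g < 2)
    (hκ : ∀ q ∈ Set.Ioo (criticalProbI d : ℝ) (criticalProbI d + s₀),
      deriv (deriv KAP) q ≤ A * (q - criticalProbI d) ^ (-a))
    (hχ : ∀ q ∈ Set.Ioo (criticalProbI d : ℝ) (criticalProbI d + s₀), CHI[q] ≤ G * (q - criticalProbI d) ^ (-g)) :
    Quant.ThetaHolderNearCritical d (1 - (a + g) / 2)
      (max (Real.sqrt (G * (A + 2 * d / ((criticalProbI d : ℝ) * (1 - criticalProbI d - s₀)) ^ 2 * s₀ ^ a)) /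
          (1 - (a + g) / 2))
        (s₀ ^ (-(1 - (a + g) / 2)))) :=
  HolderDict.thetaHolderNearCritical_of_deriv_le_rpow hd hs0 hs1.le (Real.sqrt_nonneg _) (by linarith)
    fun s hs => deriv_theta_le_rpow hd hs0 hs1 hA hG ha hκ hχ hs

end Thermo

end Summit.CriticalPhenomena.PercolationContinuityZ3.Theorems
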